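import Mathlib

/-!
# Imbrie (2016), §4.2.1 at "trunk vertices" (zeroth factor from J^{(j′)res}, length ≥ L_k): budget identity, ordered-count failure,
factorial-free count — AUDIT-CELL LEMMAS (kernel-checked arithmetic/analysis only)

CITATION HEADER (audit cell pub-imbrie, build tag b2b; seat b2b-imbrie-2-g4).
Source audited: J. Z. Imbrie, "On Many-Body Localization for Quantum Spin Chains",
J. Stat. Phys. 163 (2016) 998–1048, doi 10.1007/s10955-016-1508-x = arXiv:1403.7837v3
(bib key ImbrieJSP2016).  Passages (arXiv v3 TeX, chunk locators of the cell's SOURCES.md):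
* §4.2.1 [p0018 l.16–18]: "Each subgraph g_{i'} has subgraphs g_{(i-1)',0}, …, g_{(i-1)',n}.
  … Naïvely, the sum over g_{(i-1)',p} could produce a factor O(L_i)p, or O(L_i^n) n! in total.
  … For long graphs, we sum directly the series (ad A)^n/n!, so a combinatoric factor n! is
  admissible. … If g_{i'} is short, then … no more than 2n/9 graphs g_{(i-1)',p} can fail to
  break new ground … we obtain a factor O(L^n_i)(n!)^{2/9}. The (n!)^{2/9} is cancelled by
  the extra 1/(g_{j'}!)^{2/9} that is available for short graphs."
* (4.3) [p0015]: g_{(j-1)''}! = n! ∏_{p=0}^{n} g_{(j-2)'',p}!  (1 on jump steps).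
* §4.2.3 [p0024 l.14–16]: "(ḡ_{j'}!)^{7s/9} = (ḡ_{j'}!)^{2/9} … We have chosen constants so as
  to equalize the factorials between both sides of the Markov inequality";  s = 2/7,
  and [p0030 l.15] "(4.17) requires s < 1/3".
* (4.25), (4.30) [p0028]: J^{(j')per} = graphs of length in [L_{k-1}, L_k); the second series
  of (4.30) commutes A^{(k)} through J^{(j')res}, which contains every graph of length ≥ L_k
  [p0012 end, p0014, p0030 l.11–13].
* [p0016 l.17], [p0026 l.16–18]: for erased subgraphs "we forget the order of further
  subgraphs"; "sums over subgraphs in erased sections can be organized from left to right,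
  so no factorials are needed".
* [p0029 l.17–25], [p0030 l.5–10]: energy graphs have span < L_m/2 and, as gap graphs, "do
  not contribute factorials to (4.3)".

WHAT THIS FILE IS.  Def-free arithmetic/analysis lemmas used by the cell's adjudication of
referee query Q-P3 (SURVIVAL.md §4E′ (iv‴), rev. 5): at a vertex whose zeroth factor is a
J^{(j′)res} graph of length ℓ ≫ L ("trunk vertex"), all n A-attachments can float, so
the quoted 2n/9 sentence fails as worded.  The lemmas record (1) why the budget exponent 2/9
cannot be enlarged (it saturates a ≤ s/(1+s) at s = 2/7); (2) that ORDERED attachment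
sequences exceed the printed budget c^{|g|}(n!)^{2/9} for every c; (3) the factorial-free
count of attachment position SETS, C(ℓ,n) ≤ exp(ℓ·α(1+log(1/α))) for n ≤ αℓ, with the
per-level exponents α_j = 8/(49 L_j), L_j = (15/8)^j, summing to a closed form ≤ 5/2;
(4) the binomial resummation available where the expansion's own 1/n! is used; (5) the
arithmetic of the trunk vertex (non-dormant vertices have n ≤ 2; the R1 margin 10/693).
These are AUDIT-CELL LEMMAS about elementary quantities, NOT statements of the paper and NOT
a reproduction of its §4.2.1 counting lemma, which remains unreproduced (cell verdict
unchanged: LLA open; LLA-free part conditional on that lemma).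
-/

namespace Literature.MathematicalPhysics.QuantumLattice.Imbrie2016

open Real Finset
open scoped Nat

/-! ## 1. The factorial budget identity behind the exponent 2/9 -/

/-- `[p0024 l.14]`: with fractional-moment exponent `s = 2/7` and threshold factorial
exponent `a = 2/9`, the Markov inequality leaves `(ḡ!)^{-s(1-a)} = (ḡ!)^{-2/9}`:
the two sides are *equalized*. [cite: ImbrieJSP2016, §4.2.3 "(ḡ!)^{7s/9} = (ḡ!)^{2/9}"] -/
theorem markov_budget_equalized : (2 / 7 : ℝ) * (1 - 2 / 9) = 2 / 9 := by norm_num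

/-- A counting budget `(g!)^a` is affordable against the Markov output `(g!)^{-s(1-a)}`
iff `a ≤ s/(1+s)`. [cite: ImbrieJSP2016, §4.2.3 "equalize the factorials between both sides of the Markov inequality"] -/
theorem counting_exponent_affordable_iff {s a : ℝ} (hs : 0 < s) :
    a ≤ s * (1 - a) ↔ a ≤ s / (1 + s) := by
  rw [le_div_iff₀ (by linarith)]
  constructor <;> intro h <;> nlinarith

/-- At `s = 2/7` the largest affordable exponent is exactly `2/9` (saturated in the paper). [cite: ImbrieJSP2016, §4.2.3, s = 2/7] -/
theorem budget_exponent_at_two_sevenths : (2 / 7 : ℝ) / (1 + 2 / 7) = 2 / 9 := by norm_num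

/-- `[p0030 l.15]`: tripled denominators force `s < 1/3`, hence any affordable counting
exponent is `< 1/4`; in particular no choice of `s` makes an exponent `≥ 1/4` affordable. [cite: ImbrieJSP2016, §4.3.2 "(4.17) requires s < 1/3"] -/
theorem counting_exponent_lt_quarter {s a : ℝ} (hs₀ : 0 < s) (hs : s < 1 / 3)
    (ha : a ≤ s / (1 + s)) : a < 1 / 4 := by
  have h : s / (1 + s) < 1 / 4 := by
    rw [div_lt_iff₀ (by linarith)]
    linarith
  linarith

/-! ## 2. Ordered attachment sequences exceed the printed budget

At a trunk vertex with zeroth factor of length `ℓ = m·n` carrying `n` interior attachments,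
the ordered position count is `≥ ℓ^n = (m n)^n` while the printed budget offers
`c^{ℓ} (n!)^{2/9}` (up to the fixed attachment lengths).  For every `c` the count wins:
stated in `ℕ` after raising to the 9th power, and over `ℝ` with the real exponent `2/9`. -/

/-- For all `m ≥ 1` and `C ≥ 1` there is `n ≥ 1` with `C^{9mn} (n!)^2 < (mn)^{9n}`. (Audit-cell lemma about the quoted sentence, not a statement of the paper.)
[cite: ImbrieJSP2016, §4.2.1 "O(L^n_i) n! in total … O(L^n_i)(n!)^{2/9}"] -/
theorem ordered_count_exceeds_budget_nat (m C : ℕ) (hm : 1 ≤ m) (hC : 1 ≤ C) :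
    ∃ n : ℕ, 1 ≤ n ∧ C ^ (9 * (m * n)) * (n !) ^ 2 < (m * n) ^ (9 * n) := by
  refine ⟨C ^ (2 * m) + 1, Nat.le_add_left 1 _, ?_⟩
  set n := C ^ (2 * m) + 1 with hn
  have hn1 : 1 ≤ n := Nat.le_add_left 1 _
  have hfact : n ! ≤ n ^ n := Nat.factorial_le_pow n
  have hkey : C ^ (9 * m) < m ^ 9 * n ^ 7 := by
    have h1 : C ^ (2 * m) < n := Nat.lt_succ_self _
    have h2 : C ^ (9 * m) ≤ C ^ (14 * m) := Nat.pow_le_pow_right hC (by omega)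
    have h3 : C ^ (14 * m) = (C ^ (2 * m)) ^ 7 := by rw [← pow_mul]; ring_nf
    have h4 : (C ^ (2 * m)) ^ 7 < n ^ 7 := Nat.pow_lt_pow_left h1 (by norm_num)
    have h5 : 1 ≤ m ^ 9 := Nat.one_le_pow _ _ hm
    calc C ^ (9 * m) ≤ (C ^ (2 * m)) ^ 7 := h3 ▸ h2
      _ < n ^ 7 := h4
      _ = 1 * n ^ 7 := (one_mul _).symm
      _ ≤ m ^ 9 * n ^ 7 := Nat.mul_le_mul_right _ h5
  have hpow : (C ^ (9 * m)) ^ n < (m ^ 9 * n ^ 7) ^ n :=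
    Nat.pow_lt_pow_left hkey (by omega)
  have e1 : C ^ (9 * (m * n)) * (n ^ n) ^ 2 = (C ^ (9 * m)) ^ n * n ^ (2 * n) := by
    rw [← pow_mul, ← pow_mul]; ring
  have e2 : (m ^ 9 * n ^ 7) ^ n * n ^ (2 * n) = (m * n) ^ (9 * n) := by
    rw [mul_pow, ← pow_mul, ← pow_mul, mul_pow, pow_mul, pow_mul]
    ring
  calc C ^ (9 * (m * n)) * (n !) ^ 2
      ≤ C ^ (9 * (m * n)) * (n ^ n) ^ 2 :=
        Nat.mul_le_mul_left _ (Nat.pow_le_pow_left hfact 2)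
    _ = (C ^ (9 * m)) ^ n * n ^ (2 * n) := e1
    _ < (m ^ 9 * n ^ 7) ^ n * n ^ (2 * n) :=
        Nat.mul_lt_mul_of_pos_right hpow (by positivity)
    _ = (m * n) ^ (9 * n) := e2

/-- Real form with the paper's exponent: for every `c ≥ 1` and every attachment-length ratio
`m ≥ 1` there is `n ≥ 1` with `c^{mn} · (n!)^{2/9} < (mn)^n`.  Hence no constant `c` makes
`c^{|g|}(g!)^{2/9}` an upper bound for the number of ORDERED trunk-attachment sequences. (Audit-cell lemma, not a statement of the paper.) [cite: ImbrieJSP2016, §4.2.1 "c^{|g_{j'}|}(g_{j'}!)^{2/9}, which is just what is required"] -/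
theorem ordered_count_exceeds_budget (m : ℕ) (hm : 1 ≤ m) (c : ℝ) (hc : 1 ≤ c) :
    ∃ n : ℕ, 1 ≤ n ∧
      c ^ (m * n) * ((n ! : ℕ) : ℝ) ^ ((2 : ℝ) / 9) < (((m * n : ℕ) : ℝ)) ^ n := by
  -- dominate c by a natural number C
  obtain ⟨C, hCc⟩ := exists_nat_ge c
  have hC1 : (1 : ℝ) ≤ C := hc.trans hCc
  have hC1' : 1 ≤ C := by exact_mod_cast hC1
  obtain ⟨n, hn1, hnat⟩ := ordered_count_exceeds_budget_nat m C hm hC1'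
  refine ⟨n, hn1, ?_⟩
  have hc0 : 0 ≤ c := le_trans zero_le_one hc
  have hfac0 : (0 : ℝ) ≤ ((n ! : ℕ) : ℝ) := by positivity
  -- X := C^{mn} (n!)^{2/9} dominates the left side
  set X : ℝ := (C : ℝ) ^ (m * n) * ((n ! : ℕ) : ℝ) ^ ((2 : ℝ) / 9) with hX
  have hle : c ^ (m * n) * ((n ! : ℕ) : ℝ) ^ ((2 : ℝ) / 9) ≤ X := by
    apply mul_le_mul_of_nonneg_right (pow_le_pow_left₀ hc0 hCc _)
    exact Real.rpow_nonneg hfac0 _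
  have hX0 : 0 ≤ X := by positivity
  -- X^9 = C^{9mn} (n!)^2
  have hX9 : X ^ 9 = (C : ℝ) ^ (9 * (m * n)) * ((n ! : ℕ) : ℝ) ^ 2 := by
    rw [hX, mul_pow, ← pow_mul]
    congr 1
    · ring_nf
    · rw [← Real.rpow_natCast (((n ! : ℕ) : ℝ) ^ ((2:ℝ)/9)) 9, ← Real.rpow_mul hfac0]
      norm_num
  have hcast : (C : ℝ) ^ (9 * (m * n)) * ((n ! : ℕ) : ℝ) ^ 2 < (((m * n : ℕ) : ℝ)) ^ (9 * n) := by
    exact_mod_cast hnat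
  have h9 : X ^ 9 < ((((m * n : ℕ) : ℝ)) ^ n) ^ 9 := by
    rw [hX9, ← pow_mul]
    convert hcast using 2
    ring
  have hY0 : (0 : ℝ) ≤ (((m * n : ℕ) : ℝ)) ^ n := by positivity
  exact lt_of_le_of_lt hle (lt_of_pow_lt_pow_left₀ 9 hY0 h9)

/-! ## 3. The factorial-free count of attachment position sets -/

/-- `C(ℓ,n) ≤ (ℓ/n)^n · e^n`. [folklore] -/
theorem choose_le_div_pow_mul_exp (ℓ n : ℕ) (hn : 1 ≤ n) :
    (ℓ.choose n : ℝ) ≤ ((ℓ : ℝ) / n) ^ n * exp n := by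
  have h1 : (ℓ.choose n : ℝ) ≤ (ℓ : ℝ) ^ n / n ! := by
    have := Nat.choose_le_pow_div n ℓ (α := ℝ)
    simpa using this
  have h2 : (n : ℝ) ^ n / n ! ≤ exp n := Real.pow_div_factorial_le_exp (n : ℝ) (by positivity) n
  have hn' : (0 : ℝ) < n := by exact_mod_cast hn
  have hf : (0 : ℝ) < n ! := by positivity
  calc (ℓ.choose n : ℝ) ≤ (ℓ : ℝ) ^ n / n ! := h1
    _ = ((ℓ : ℝ) / n) ^ n * ((n : ℝ) ^ n / n !) := by
        rw [div_pow]
        field_simp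
    _ ≤ ((ℓ : ℝ) / n) ^ n * exp n := mul_le_mul_of_nonneg_left h2 (by positivity)

/-- The entropy-type exponent `u ↦ u(1 + log(1/u))` is monotone on `(0,1]`
(elementary: `log x ≤ x - 1`). [folklore] -/
theorem mul_one_add_log_inv_mono {u v : ℝ} (hu : 0 < u) (huv : u ≤ v) (hv : v ≤ 1) :
    u * (1 + log (1 / u)) ≤ v * (1 + log (1 / v)) := by
  have hv0 : 0 < v := lt_of_lt_of_le hu huv
  have h1 : log (v / u) ≤ v / u - 1 := Real.log_le_sub_one_of_pos (by positivity)
  rw [Real.log_div hv0.ne' hu.ne'] at h1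
  have h2 : u * log v - u * log u ≤ v - u := by
    have h := mul_le_mul_of_nonneg_left h1 hu.le
    have e : u * (v / u - 1) = v - u := by field_simp
    rw [e, mul_sub] at h
    exact h
  have hlogv : log v ≤ 0 := Real.log_nonpos hv0.le hv
  have hprod : 0 ≤ (v - u) * (-log v) := mul_nonneg (sub_nonneg.mpr huv) (neg_nonneg.mpr hlogv)
  rw [one_div, Real.log_inv, one_div, Real.log_inv]
  nlinarith [h2, hprod]

/-- Sparse subsets cost no factorial: if `n ≤ α ℓ` with `0 < α ≤ 1` then
`C(ℓ,n) ≤ exp(ℓ · α(1 + log(1/α)))`. [folklore] -/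
theorem choose_le_exp_mul_entropy (ℓ n : ℕ) {α : ℝ} (hα : 0 < α) (hα1 : α ≤ 1)
    (hn : (n : ℝ) ≤ α * ℓ) :
    (ℓ.choose n : ℝ) ≤ exp (ℓ * (α * (1 + log (1 / α)))) := by
  have hent : 0 ≤ α * (1 + log (1 / α)) := by
    have : 0 ≤ log (1 / α) := Real.log_nonneg (by rw [le_div_iff₀ hα]; linarith)
    positivity
  rcases Nat.eq_zero_or_pos n with rfl | hn1
  · simp only [Nat.choose_zero_right, Nat.cast_one]
    exact Real.one_le_exp (by positivity)
  rcases Nat.eq_zero_or_pos ℓ with rfl | hl1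
  · exfalso
    have : (n : ℝ) ≤ 0 := by simpa using hn
    have : (0 : ℝ) < n := by exact_mod_cast hn1
    linarith
  have hl : (0 : ℝ) < ℓ := by exact_mod_cast hl1
  have hnr : (0 : ℝ) < n := by exact_mod_cast hn1
  have hu : (n : ℝ) / ℓ ≤ α := by rw [div_le_iff₀ hl]; exact hn
  have step1 := choose_le_div_pow_mul_exp ℓ n hn1
  have hpos : (0 : ℝ) < (ℓ : ℝ) / n := by positivity
  have e1 : ((ℓ : ℝ) / n) ^ n * exp n = exp (n * (1 + log ((ℓ : ℝ) / n))) := by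
    rw [← Real.exp_log (pow_pos hpos n), ← Real.exp_add, Real.log_pow]
    congr 1
    ring
  have e2 : (1 : ℝ) / ((n : ℝ) / ℓ) = (ℓ : ℝ) / n := by rw [one_div, inv_div]
  have key : (ℓ : ℝ) * ((n : ℝ) / ℓ * (1 + log (1 / ((n : ℝ) / ℓ)))) =
      n * (1 + log ((ℓ : ℝ) / n)) := by
    rw [e2]
    field_simp
  have mono := mul_one_add_log_inv_mono (u := (n : ℝ) / ℓ) (v := α) (by positivity) hu hα1
  calc (ℓ.choose n : ℝ) ≤ ((ℓ : ℝ) / n) ^ n * exp n := step1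
    _ = exp (n * (1 + log ((ℓ : ℝ) / n))) := e1
    _ = exp (ℓ * ((n : ℝ) / ℓ * (1 + log (1 / ((n : ℝ) / ℓ))))) := by rw [key]
    _ ≤ exp (ℓ * (α * (1 + log (1 / α)))) := by
        apply Real.exp_le_exp.mpr
        exact mul_le_mul_of_nonneg_left mono hl.le

/-- Shortness caps the number of floating attachments: `n · (7/8)L ≤ ℓ/7 ↔ n ≤ (8/49)(ℓ/L)`
(attachments have length `≥ (7/8)L`, `L = L_{k-1}`; short means `|g| ≤ (8/7)|I(g)|` with
`|I(g)| = ℓ`). [cite: ImbrieJSP2016, §4.2.1 "a graph g_{j'} is long if |g_{j'}| > 8/7 |I(g_{j'})|" and (4.4)] -/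
theorem floating_cap_iff (n ℓ L : ℝ) (hL : 0 < L) :
    n * ((7 / 8) * L) ≤ ℓ / 7 ↔ n ≤ 8 / 49 * (ℓ / L) := by
  rw [show (8 : ℝ) / 49 * (ℓ / L) = (ℓ / 7) / ((7 / 8) * L) by field_simp; ring]
  exact (le_div_iff₀ (by positivity)).symm

/-- Per-level exponents summed over all levels: with `α_j = 8/(49 L_j) = (8/49)(8/15)^j`,
`Σ_j α_j(1 + log(1/α_j)) = (8/49)[(15/7)(1 + log(49/8)) + (120/49) log(15/8)]`
(numerically 1.2353; per-site factor e^{1.2353} ≈ 3.44, uniformly over levels — the same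
super-linear-growth mechanism as the paper's `∏ L_i^{1/L_i}`, cf. `hasSum_log_scale_div_scale`). (Audit-cell analogue of the paper's per-site factor; not a statement of the paper.)
[cite: ImbrieJSP2016, §4.2.1 "the 'combinatoric factor per site' L_i^{1/L_i}"] -/
theorem hasSum_trunk_entropy :
    HasSum (fun j : ℕ => (8 / 49 : ℝ) * (8 / 15) ^ j * (1 + log (1 / ((8 / 49 : ℝ) * (8 / 15) ^ j))))
      ((8 / 49 : ℝ) * ((15 / 7) * (1 + log (49 / 8)) + (120 / 49) * log (15 / 8))) := by
  have hlog : ∀ j : ℕ, log (1 / ((8 / 49 : ℝ) * (8 / 15) ^ j)) = log (49 / 8) + j * log (15 / 8) := by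
    intro j
    rw [one_div, mul_inv, ← inv_pow, Real.log_mul (by norm_num) (by positivity), Real.log_pow]
    norm_num [inv_div]
  have h1 : HasSum (fun j : ℕ => ((8 : ℝ) / 15) ^ j) (15 / 7) := by
    have := hasSum_geometric_of_lt_one (r := (8 : ℝ) / 15) (by norm_num) (by norm_num)
    rw [show ((1 : ℝ) - 8 / 15)⁻¹ = 15 / 7 by norm_num] at this
    exact this
  have h2 : HasSum (fun j : ℕ => (j : ℝ) * ((8 : ℝ) / 15) ^ j) (120 / 49) := by
    have := hasSum_coe_mul_geometric_of_norm_lt_one (𝕜 := ℝ) (r := (8 : ℝ) / 15)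
      (by rw [Real.norm_eq_abs, abs_of_pos (by norm_num)]; norm_num)
    rw [show (8 : ℝ) / 15 / (1 - 8 / 15) ^ 2 = 120 / 49 by norm_num] at this
    exact this
  have h3 := (h1.mul_left ((8 / 49 : ℝ) * (1 + log (49 / 8)))).add
    (h2.mul_left ((8 / 49 : ℝ) * log (15 / 8)))
  have hf : (fun j : ℕ => (8 / 49 : ℝ) * (8 / 15) ^ j * (1 + log (1 / ((8 / 49 : ℝ) * (8 / 15) ^ j))))
      = (fun j : ℕ => (8 / 49 : ℝ) * (1 + log (49 / 8)) * ((8 : ℝ) / 15) ^ j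
          + (8 / 49 : ℝ) * log (15 / 8) * ((j : ℝ) * ((8 : ℝ) / 15) ^ j)) := by
    funext j
    rw [hlog j]
    ring
  have hv : (8 / 49 : ℝ) * ((15 / 7) * (1 + log (49 / 8)) + (120 / 49) * log (15 / 8))
      = (8 / 49 : ℝ) * (1 + log (49 / 8)) * (15 / 7) + (8 / 49 : ℝ) * log (15 / 8) * (120 / 49) := by
    ring
  rw [hf, hv]
  exact h3

/-- A crude closed-form ceiling: the summed exponent is `≤ 5/2` (so the factorial-free trunk
count costs at most a factor `e^{5/2}` per site, uniformly over all levels). [cite: ImbrieJSP2016, §4.2.1 "As the product of L_i^{1/L_i} is bounded" (analogue)] -/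
theorem trunk_entropy_le :
    (8 / 49 : ℝ) * ((15 / 7) * (1 + log (49 / 8)) + (120 / 49) * log (15 / 8)) ≤ 5 / 2 := by
  have h1 : log (49 / 8 : ℝ) ≤ 49 / 8 - 1 := Real.log_le_sub_one_of_pos (by norm_num)
  have h2 : log (15 / 8 : ℝ) ≤ 15 / 8 - 1 := Real.log_le_sub_one_of_pos (by norm_num)
  nlinarith [h1, h2]

/-! ## 4. Where the expansion's own `1/n!` is used: binomial resummation -/

/-- Summing the trunk family with the native coefficient (unordered attachment sets, factor
`2` per commutator term and `x` per attachment root) gives `(1 + 2x)^ℓ`. [folklore] -/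
theorem trunk_binomial_resummation (ℓ : ℕ) (x : ℝ) :
    ∑ n ∈ Finset.range (ℓ + 1), (ℓ.choose n : ℝ) * (2 * x) ^ n = (1 + 2 * x) ^ ℓ := by
  rw [show (1 : ℝ) + 2 * x = 2 * x + 1 from add_comm _ _, add_pow]
  apply Finset.sum_congr rfl
  intro k _
  simp [mul_comm]

/-- `(1 + 2x)^ℓ ≤ e^{2xℓ}`: the trunk family renormalises the trunk's decay rate by at most `e^{2x}`
per site. [folklore] -/
theorem trunk_family_factor_le_exp (ℓ : ℕ) {x : ℝ} (hx : 0 ≤ x) :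
    (1 + 2 * x) ^ ℓ ≤ exp (2 * x * ℓ) := by
  have h : 1 + 2 * x ≤ exp (2 * x) := by linarith [Real.add_one_le_exp (2 * x)]
  calc (1 + 2 * x) ^ ℓ ≤ (exp (2 * x)) ^ ℓ := pow_le_pow_left₀ (by linarith) h ℓ
    _ = exp (2 * x * ℓ) := by rw [← Real.exp_nat_mul]; congr 1; ring

/-- The per-step renormalisations multiply to at most `exp` of their (convergent) sum. [folklore] -/
theorem prod_one_add_le_exp_sum (K : ℕ) (x : ℕ → ℝ) (hx : ∀ k, 0 ≤ x k) :
    ∏ k ∈ Finset.range K, (1 + 2 * x k) ≤ exp (2 * ∑ k ∈ Finset.range K, x k) := by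
  rw [Finset.mul_sum, Real.exp_sum]
  apply Finset.prod_le_prod
  · intro k _; linarith [hx k]
  · intro k _; linarith [Real.add_one_le_exp (2 * x k)]

/-! ## 5. Arithmetic of the trunk vertex -/

/-- Non-dormant vertices are small: a level-`k′` graph summed at step `k+1` has length
`< L_{k+1} = (15/8)^2 L_{k-1}` and children of length `≥ (7/8) L_{k-1}` after a zeroth factor of
length `≥ L_{k-1}`, so `n < 161/56 < 3`; with a zeroth factor from J^{res} (length `≥ L_k`),
`n < 15/8 < 2`.  Vertices with three or more A-children occur only in dormant graphs. (Audit-cell arithmetic.) [cite: ImbrieJSP2016, (4.25) and (4.4) "the minimum size of a graph g_{j''} in an A^{(k)} term is (7/8)L_{k-1}"] -/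
theorem nondormant_top_vertex :
    ((15 / 8 : ℝ) ^ 2 - 1) / (7 / 8) = 161 / 56 ∧ (161 / 56 : ℝ) < 3 ∧
    ((15 / 8 : ℝ) ^ 2 - 15 / 8) / (7 / 8) = 15 / 8 ∧ (15 / 8 : ℝ) < 2 := by norm_num

/-- Smallest instance (level 2′): trunk = straight step-1 walk with 28 flips (in J^{(1′)res}
since ≥ 4), two interior attachments of length 2: `|g| = 32 = (8/7)·28` (short, boundary
case) and both attachments float: `2 > (2/9)·2`. (Audit-cell arithmetic.) [cite: ImbrieJSP2016, §3.2 "large graphs (|g_{1'}| ≥ 4) … form J^{(1')res}" and §4.2.1] -/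
theorem smallest_trunk_instance :
    (28 + 2 * 2 : ℚ) = 8 / 7 * 28 ∧ (2 : ℚ) > 2 / 9 * 2 ∧ (4 : ℕ) ≤ 28 := by norm_num

/-- The R1 margin (ordered labelling, printed budget, factorial-poorest trunks).  Needed
exponent coefficient `(8/49)(7/9) = 8/63`; available `(2/9)/c′` where `c′ L` bounds the trunk
length per factorial-bearing child; children `< L_i` plus gap graphs `≤ (15/14)L_{i-1} =
(4/7)L_i` give `c′ ≤ 11/7`, and `(2/9)/(11/7) = 14/99 > 8/63` with margin `10/693`; the
break-even is `c′ = 7/4`.  Gap-graph length per gap: `Σ_{m<j} (15/16)L_m ≤ (225/112)L_{j-1}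
= (15/14)L_j`. (Audit-cell arithmetic.) [cite: ImbrieJSP2016, §4.3.2 "leading to a maximum range of … ≤ (15/14)L_j"] -/
theorem trunk_margin_arith :
    (8 / 49 : ℝ) * (7 / 9) = 8 / 63 ∧ (2 / 9 : ℝ) / (11 / 7) = 14 / 99 ∧
    (14 / 99 : ℝ) - 8 / 63 = 10 / 693 ∧ (0 : ℝ) < 10 / 693 ∧ (2 / 9 : ℝ) / (7 / 4) = 8 / 63 ∧
    (1 : ℝ) + 15 / 14 * (8 / 15) = 11 / 7 ∧ (11 / 7 : ℝ) < 7 / 4 ∧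
    (15 / 16 : ℝ) * (15 / 7) = 225 / 112 ∧ (225 / 112 : ℝ) * (8 / 15) = 15 / 14 ∧
    ((1 : ℝ) / 2) * (15 / 8) = 15 / 16 ∧ (7 / 8 : ℝ) < 15 / 16 := by norm_num

/-- The affordability criterion of R1 as an iff in `c′`. (Audit-cell arithmetic.) [cite: ImbrieJSP2016, §4.3.2] -/
theorem trunk_margin_iff {c' : ℝ} (hc : 0 < c') : (8 : ℝ) / 63 ≤ (2 / 9) / c' ↔ c' ≤ 7 / 4 := by
  rw [le_div_iff₀ hc]
  constructor <;> intro h <;> linarith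

end Literature.MathematicalPhysics.QuantumLattice.Imbrie2016
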